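import Summits.ResolutionOfSingularities.ResolutionOfSingularities.Theses.MaxContactCut
import Summits.ResolutionOfSingularities.ResolutionOfSingularities.Theorems.VeryNearCutClasses
import Summits.ResolutionOfSingularities.ResolutionOfSingularities.Theorems.VeryNearCutKernels
import Summits.ResolutionOfSingularities.ResolutionOfSingularities.Theorems.MaxContactCutTauLadder
import Summits.ResolutionOfSingularities.ResolutionOfSingularities.Theorems.MaxContactCutGenericPointCut
import Summits.ResolutionOfSingularities.ResolutionOfSingularities.Theorems.MaxContactCutFaceFormCut
import HarnessLib

/-!
# MaxContactCutVeryNearCut — the g10 node «VeryNearCut» wired to the route MaxContactCut BY NAME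
(decomp-res node N53, lens-2 g10 sha256 323417289ddca7f6; CRITIC-LEDGER row 66 CLEARED AS ENGINE + RE-LOCATION NODE;
phase 3 of 3)

Vocabulary: `Theorems/VeryNearCutClasses` (phase 1a: the ideals `𝔫_w`, `Q_w(λ)`, the persistence shape, the
NEAR-GENERIC / POWER-FACE / NEAR-SPECIAL point classes, the graded families `SeqNGen n` / `SeqNSpec n` /
`SeqNSpecDeep n` / `SeqNSpecPower n` / `SeqNSpecFin n`, the typed engine `VeryNearExit` with its paper proof
(N)(V)(T), the ports `OneShotPortTwo n` / `OrderOneContact`) and `Theorems/VeryNearCutKernels` (phase 1b: the exact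
cuts `seqDimFour_one_iff`, `seqNSpec_iff`, the engine at work `nearGenericRung_of_engine`, the comparison with N50).
Route asides (MaxContactCut, `aside · rank 9`, refining `RungOne` 29273 and re-locating N50's residual 31577):
`VNGenericRung` [DECIDED-MOD-PORT(M), prover item; engine = prover target #19, ⊋ `FFGenericRung` 31576],
`VNSpecialRung` [located residual, score 0, ≡ 31577 modulo the decided piece], `VNSpecialDeep` / `VNSpecialPower` /
`VNSpecialFin` [UNDECIDED · INSTRUMENTABLE strata, EXACT three-way cut].

Kernels (all by name, 0 sorry):
* EXACT at the rung: `RungOne ⟺ VNGenericRung ∧ VNSpecialRung` (`rungOne_iff`, pure logic), and the residual cut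
  `VNSpecialRung ⟺ VNSpecialDeep ∧ VNSpecialPower ∧ VNSpecialFin` (`vnSpecialRung_iff_strata`);
* DECIDED HALF: `VNGenericRung` from the engine and the two ports (`vnGenericRung_of_engine`), so
  `closes_of_engine : VeryNearExit → (∀ n ≥ 2, OneShotPortTwo n) → OrderOneContact → VNSpecialRung → RungOne` and
  `closes_of_strata` (the three strata in place of the residual);
* MAP EDGES: to the located core 28544 (`closes_core`, via `MaxContactCutTauLadder.closes`), to g7's closed-point
  core `ClosedPointCoreAll` 30461 (`closes_closedPointCore`, via `MaxContactCutGenericPointCut`), to `E 1`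
  (`e_one_of_pieces`);
* EDGES TO N50 (asides 31576–31578, via `MaxContactCutFaceFormCut`): `VNGenericRung ⇒ FFGenericRung` (g10 decides
  MORE), `FFSpecialRung ⇒ VNSpecialRung` (the located residual SHRINKS by letter) and `FFSpecialRung ⟺ VNSpecialRung`
  modulo `VNGenericRung` (honesty), `FFSpecialDeep ⇒ VNSpecialDeep`, `closes_of_ffSpecialRung`.
ROOT BY NAME is the route's `closes`.  WHY THIS IS NOVEL (critic row 66): the decided class is cut by Hironaka's
VERY-NEAR test at threshold `n` with a FINITE RATIONAL exception list (the ideals `Q_w(λ)`), not by the face form's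
multiplicity `n − 1` alone — strictly more is decided at every `(p, n)` and every residue field by one blow-up, and the
residual is re-located onto the power-face / finite-bad-locus strata, where the in-frame bed (28 / 7 / 0) says the
face form carries no further information.  Census data: HOME/CRITIC-LEDGER.md row 66; census/T-face-2.md.
(Sources: CossartPiltant2008 Prop. 4.2, Lemma 4.3; Hironaka1970 Thm 2, 3; CossartJannsenSaito2020 Thm 9.3/9.6;
CossartPiltant2019 Rem. 3.2; Giraud1975; BierstoneGrigorievMilmanWlodarczyk2011 §3.1.)
-/

namespace Summit.ResolutionOfSingularities.ResolutionOfSingularities.Theorems.MaxContactCutVeryNearCut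

open CategoryTheory AlgebraicGeometry
open Literature.AlgebraicGeometry.Resolution
open Summit.ResolutionOfSingularities.ResolutionOfSingularities.Theses
open Summit.ResolutionOfSingularities.ResolutionOfSingularities.Theorems
open WeakOrderReduction VeryNearCutClasses VeryNearCutKernels

/-! ## The asides unfolded -/

/-- `VNGenericRung` is the near-generic half. [folklore] -/
theorem vnGenericRung_iff : MaxContactCut.VNGenericRung ↔ NearGenericRung := Iff.rfl

/-- `VNSpecialRung` is the located residual. [folklore] -/
theorem vnSpecialRung_iff : MaxContactCut.VNSpecialRung ↔ NearSpecialRung := Iff.rfl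

/-- `VNSpecialDeep` is the deep stratum at every marking. [folklore] -/
theorem vnSpecialDeep_iff : MaxContactCut.VNSpecialDeep ↔ (E 2 → ∀ n : ℕ, 1 ≤ n → SeqNSpecDeep n) := Iff.rfl

/-- `VNSpecialPower` is the power-face stratum at every marking. [folklore] -/
theorem vnSpecialPower_iff : MaxContactCut.VNSpecialPower ↔ (E 2 → ∀ n : ℕ, 1 ≤ n → SeqNSpecPower n) := Iff.rfl

/-- `VNSpecialFin` is the finite-bad-locus stratum at every marking. [folklore] -/
theorem vnSpecialFin_iff : MaxContactCut.VNSpecialFin ↔ (E 2 → ∀ n : ℕ, 1 ≤ n → SeqNSpecFin n) := Iff.rfl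

/-! ## EXACT at the rung (pure logic) -/

/-- **EXACT**: `RungOne ⟺ VNGenericRung ∧ VNSpecialRung` (excluded middle on «some top point is near-special»,
marking by marking). [folklore] -/
theorem rungOne_iff : MaxContactCut.RungOne ↔ MaxContactCut.VNGenericRung ∧ MaxContactCut.VNSpecialRung := by
  constructor
  · intro h
    exact ⟨fun hE2 n hn => seqNGen_of_seqDimFour_one (h hE2 n hn),
      fun hE2 n hn => seqNSpec_of_seqDimFour_one (h hE2 n hn)⟩
  · rintro ⟨hG, hS⟩ hE2 n hn
    exact seqDimFour_one_iff.mpr ⟨hG hE2 n hn, hS hE2 n hn⟩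

/-- NECESSITY by letter: the near-generic half is implied by the rung. [folklore] -/
theorem nearGenericRung_of_rungOne (h : MaxContactCut.RungOne) : MaxContactCut.VNGenericRung := (rungOne_iff.mp h).1

/-- NECESSITY by letter: the located residual is implied by the rung. [folklore] -/
theorem nearSpecialRung_of_rungOne (h : MaxContactCut.RungOne) : MaxContactCut.VNSpecialRung := (rungOne_iff.mp h).2

/-- HONESTY KERNEL: modulo the (decided) near-generic half, the located residual IS the rung. [folklore] -/
theorem nearSpecialRung_iff_rungOne (hG : MaxContactCut.VNGenericRung) :
    MaxContactCut.VNSpecialRung ↔ MaxContactCut.RungOne :=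
  ⟨fun hS => rungOne_iff.mpr ⟨hG, hS⟩, nearSpecialRung_of_rungOne⟩

/-- **EXACT three-way cut of the located residual** into its strata (nested excluded middle, marking by marking).
[folklore] -/
theorem vnSpecialRung_iff_strata : MaxContactCut.VNSpecialRung ↔
    MaxContactCut.VNSpecialDeep ∧ MaxContactCut.VNSpecialPower ∧ MaxContactCut.VNSpecialFin :=
  nearSpecialRung_iff_strata

/-- Recomposition: the three strata give back the located residual. [folklore] -/
theorem vnSpecialRung_of_strata (hD : MaxContactCut.VNSpecialDeep) (hW : MaxContactCut.VNSpecialPower)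
    (hF : MaxContactCut.VNSpecialFin) : MaxContactCut.VNSpecialRung :=
  vnSpecialRung_iff_strata.mpr ⟨hD, hW, hF⟩

/-! ## The decided half and the deciding implication -/

/-- **`VNGenericRung` is DECIDED modulo the typed pieces**: the engine `VeryNearExit` (port L, prover target #19) and
the ports `OneShotPortTwo n` (M), `OrderOneContact` (S). [folklore] -/
theorem vnGenericRung_of_engine (hE : VeryNearExit) (hP : ∀ n : ℕ, 2 ≤ n → OneShotPortTwo n)
    (h1 : FaceFormCutClasses.OrderOneContact) : MaxContactCut.VNGenericRung :=
  nearGenericRung_of_engine hE hP h1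

/-- **DECIDING IMPLICATION OF THE NODE**: `MaxContactCut.RungOne` (stmt-29273) BY NAME from the two halves.
[folklore] -/
theorem closes (hG : MaxContactCut.VNGenericRung) (hS : MaxContactCut.VNSpecialRung) : MaxContactCut.RungOne :=
  rungOne_iff.mpr ⟨hG, hS⟩

/-- `RungOne` BY NAME from the typed ENGINE, the ports and the located residual. [folklore] -/
theorem closes_of_engine (hE : VeryNearExit) (hP : ∀ n : ℕ, 2 ≤ n → OneShotPortTwo n)
    (h1 : FaceFormCutClasses.OrderOneContact) (hS : MaxContactCut.VNSpecialRung) : MaxContactCut.RungOne :=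
  closes (vnGenericRung_of_engine hE hP h1) hS

/-- `RungOne` BY NAME from the engine, the ports and the THREE residual strata. [folklore] -/
theorem closes_of_strata (hE : VeryNearExit) (hP : ∀ n : ℕ, 2 ≤ n → OneShotPortTwo n)
    (h1 : FaceFormCutClasses.OrderOneContact) (hD : MaxContactCut.VNSpecialDeep) (hW : MaxContactCut.VNSpecialPower)
    (hF : MaxContactCut.VNSpecialFin) : MaxContactCut.RungOne :=
  closes_of_engine hE hP h1 (vnSpecialRung_of_strata hD hW hF)

/-- `E 1` BY NAME from `E 2` and the two halves. [folklore] -/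
theorem e_one_of_pieces (hE2 : E 2) (hG : MaxContactCut.VNGenericRung) (hS : MaxContactCut.VNSpecialRung) : E 1 :=
  closes hG hS hE2

/-! ## Map edges BY NAME -/

/-- MAP EDGE to the declared residual `MaxContactCut.StepPICoreDimFour` (stmt-28544) BY NAME, through the tree kernel
`MaxContactCutTauLadder.closes`. [folklore] -/
theorem closes_core (h5 : MaxContactCutExhaustion.ContactOrderSequenceDimFour) (r4 : MaxContactCut.RungFour)
    (r3 : MaxContactCut.RungThree) (r2 : MaxContactCut.RungTwo) (hG : MaxContactCut.VNGenericRung)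
    (hS : MaxContactCut.VNSpecialRung) (hSS : MaxContactCut.SequenceToStepAll) : MaxContactCut.StepPICoreDimFour :=
  (MaxContactCutTauLadder.closes h5 r4 r3 r2 (closes hG hS) hSS).2.2.2.2

/-- MAP EDGE to the located residual `MaxContactCut.ClosedPointCoreAll` (stmt-30461) BY NAME. [folklore] -/
theorem closes_closedPointCore (hE2 : E 2) (h2 : MaxContactCut.RoundCodimTwoAll)
    (h3 : MaxContactCut.RoundCodimThreeAll) (hG : MaxContactCut.VNGenericRung) (hS : MaxContactCut.VNSpecialRung) :
    MaxContactCut.ClosedPointCoreAll :=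
  (MaxContactCutGenericPointCut.rungOne_iff_core_of_rounds hE2 h2 h3).mp (closes hG hS)

/-! ## Edges to N50 `FaceFormCut` (asides 31576–31578) BY NAME -/

/-- **EDGE to 31576**: `VNGenericRung ⇒ FFGenericRung` (g10 decides more: the g10 decided piece closes the tree's g9
decided aside BY NAME). [folklore] -/
theorem ffGenericRung_of_vnGenericRung (h : MaxContactCut.VNGenericRung) : MaxContactCut.FFGenericRung :=
  MaxContactCutFaceFormCut.ffGenericRung_iff.mpr fun hE2 n hn => seqGen_of_seqNGen (h hE2 n hn)

/-- **EDGE from 31577**: `FFSpecialRung ⇒ VNSpecialRung` (the located residual shrinks BY LETTER from g9 to g10).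
[folklore] -/
theorem vnSpecialRung_of_ffSpecialRung (h : MaxContactCut.FFSpecialRung) : MaxContactCut.VNSpecialRung :=
  fun hE2 n hn => seqNSpec_of_seqSpec ((MaxContactCutFaceFormCut.ffSpecialRung_iff.mp h) hE2 n hn)

/-- **HONESTY / EXACTNESS w.r.t. the tree residual**: modulo the g10 decided piece, the g9 located residual
`FFSpecialRung` (31577) and the g10 located residual `VNSpecialRung` are EQUIVALENT (pure logic). [folklore] -/
theorem ffSpecialRung_iff_vnSpecialRung (hG : MaxContactCut.VNGenericRung) :
    MaxContactCut.FFSpecialRung ↔ MaxContactCut.VNSpecialRung :=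
  ⟨vnSpecialRung_of_ffSpecialRung, fun hS => MaxContactCutFaceFormCut.specialRung_of_rungOne (closes hG hS)⟩

/-- **EDGE from 31578**: the tree's deep stratum gives the g10 deep stratum BY LETTER (a near-special deep point is a
face-special deep point; `IsDeepFacePt` is the tree predicate itself). [folklore] -/
theorem vnSpecialDeep_of_ffSpecialDeep (h : MaxContactCut.FFSpecialDeep) : MaxContactCut.VNSpecialDeep := by
  intro hE2 n hn p hp k _ _ Y g h1 h2 h3 hY h4 I hord hex
  obtain ⟨y, hy, hs, hd⟩ := hex
  exact (MaxContactCutFaceFormCut.ffSpecialDeep_iff.mp h) hE2 n hn p hp k Y g h1 h2 h3 hY h4 I hord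
    ⟨y, hy, isFaceSpecialPt_of_isNearSpecialPt hs, hd⟩

/-- The tree residual 31577 gives all three g10 strata. [folklore] -/
theorem strata_of_ffSpecialRung (h : MaxContactCut.FFSpecialRung) :
    MaxContactCut.VNSpecialDeep ∧ MaxContactCut.VNSpecialPower ∧ MaxContactCut.VNSpecialFin :=
  vnSpecialRung_iff_strata.mp (vnSpecialRung_of_ffSpecialRung h)

/-- `RungOne` BY NAME from the g10 decided piece and the TREE residual 31577 (consistency with
`MaxContactCutFaceFormCut.closes`). [folklore] -/
theorem closes_of_ffSpecialRung (hG : MaxContactCut.VNGenericRung) (hS : MaxContactCut.FFSpecialRung) :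
    MaxContactCut.RungOne :=
  closes hG (vnSpecialRung_of_ffSpecialRung hS)

end Summit.ResolutionOfSingularities.ResolutionOfSingularities.Theorems.MaxContactCutVeryNearCut
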